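import Literature.MathematicalPhysics.QuantumFieldTheory.Balaban1983to89.Node00.DressedSlotsOfRecord12
import Literature.MathematicalPhysics.QuantumFieldTheory.Balaban1983to89.Node00.RStepProvisosIntOfRecord

/-!
# N20 (NE7b) WITHOUT A TOWER: a bad class of level-`k` histories weighs at most `W` of the total as soon as (i) every bad history is FIBREWISE DOMINATED by its image under a
# removal map — `∫⌈_{Z′(s)} t_s ≤ z(s)·∫⌈_{Z′(s)} t_{rm s}` at every configuration ([LF-II] (1.79) «for all large field regions» + the improved (1.89), read on the (0.3) fibre ratio of
# [IV]) — and (ii) the factors `z` re-inserted over each removal fibre sum to at most `W`; the fibre sums of multiplicative factors over compatible families of old components are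
# at most `exp(Σ x) − 1`

Cell `pub-ymgap`, YM-PLAN Track A (HUMAN RULING D-0062); seat `pub-ymgap-dag-n20-d` (R134 (a) N20 NE7b s3 «W_K < 1, Σ W_K < ∞ from [B16] (1.79)–(1.89) pp. 383–387 directly»), gen 39.
`--kind proof --supports stmt-QuantumFields-27366 --as helper` (K3⁸); COUNT-NEUTRAL; THEOREMS ONLY (0 `def`).  [III] = [Balaban1988Convergent]; [IV] = [Balaban1989LargeFieldI];
[LF-II] = [Balaban1989LargeFieldII].  Companions: `Node00.RStepRepr218` (def-R: `rratio r fib a a′ = ∫⌈_{fib a} t_a ∕ ∫⌈_{fib a} t_{a′}`, the (0.3) ratio), `Node00.RStepProvisosIntOfRecord`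
(def-R FILE 17: `lintegral_lmarginal_ofReal_eq`), `T4ObservableTelescope.integral_fibreIntegral_eq` (`∫dV ∫dV⌈_{Z′} f = ∫dV f`), `Node00.DressedSlotsOfRecord12` (`classWeightOfDatum₉`).

WHY (the currency).  The lineage's sockets for NE7b's `RelWeightBound` (gen 33–38: `…CoPHKComponentSizeBlocks*`) consume per-level LETTERS «the classes whose level-`j` large-field region
meets a given block animal weigh at most `δ^n` of the total» and assemble them by successive conditioning along def-T's sequence index; the conditioning identity (T) holds at the LIVE
pin only (LOCATED-2), and at a history-rewriting pin ([IV] (0.3): `Z ↦ Z″`) the 𝐑-step re-books mass across `init`-fibres — it is linear PER SOURCE (`normTerm fib new old` is linear in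
`old`) but not in the family, so a tower there needs letters on re-profiled PORTIONS of class densities, which is not print's currency.  PRINT's currency is a SUP bound, per history, on the
conditional 𝐓-operation of a large-field region: [LF-II] (1.79) p. 383 (product over the region's components of `exp(−½γ₀A₁²p₀²(g_j)(d′_j+1) − 2p₀(g_j))`, «the above inequality holds for
all large field regions, not only for the regions satisfying the conditions (i), (ii)», p. 384 l. 1–2) and p. 387 ll. 25–29 («an improved bound (1.89), with the additional term −κ₁d_k(X)
in the exponential»).  On def-R's objects that operation is the FIBRE RATIO of (0.3): `rratio r fib s s″ (V) = ∫⌈_{Z′(s)} t_s ∕ ∫⌈_{Z′(s)} t_{s″}` (`Node00.RStepRepr218`).  A sup bound on it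
INTEGRATES (§1: `∫dV t_s = ∫dV ∫⌈ t_s ≤ z·∫dV ∫⌈ t_{s″} = z·∫dV t_{s″}`), so a bad class `B` of FINAL-level histories equipped with a removal map `rm` (the history with its offending
components declared small) is dominated class-wise by the image classes, with the multiplicity `Σ_{s ∈ B : rm s = σ} z(s)` per image `σ` (§2) — NO tower, NO telescoping, NO pin.  When
the factors are multiplicative over the removed components and a removal fibre injects into the compatible families of a finite stock of candidate components, that multiplicity is at
most `Π(1 + x) − 1 ≤ exp(Σ x) − 1` (§3).  §4 reads §2 on the dressed class weights `classWeightOfDatum₉` of a Stage-9 tuple at one `(p, g, k, t)`: the shape of `RelWeightBound.bad_left ∕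
bad_right` at that `(K, t)` and of the level letters `hE` of `…CoPHKComponentSizeBlocks.levelLetter_of_blockEnergyLetters_left ∕ _right`, from ONE displayed per-history letter.

WHAT IS PROVED (kernel; finite sums and Fubini over def-R's fibre integral; every analytic input a displayed hypothesis).
§1 `lintegral_ofReal_fibreIntegral_le`, `integrable_fibreIntegral_of_integrable` (an integrable non-negative measurable density has an integrable fibre integral), ★ `integral_le_mul_integral_of_fibreDom`
(FIBREWISE domination `∫⌈_s f ≤ z·∫⌈_s g` everywhere ⇒ `∫ f ≤ z·∫ g`; no sign condition on `z` is needed), `fibreDom_of_ratio_le` (the domination from a sup bound on the ratio `∫⌈ f ∕ ∫⌈ g ≤ z` plus the support clause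
«`∫⌈ g = 0 ⇒ ∫⌈ f = 0`»), `fibreDom_of_rratio_le` (the same on def-R's `rratio` of a `Step.Repr218`).
§2 ★★ `sum_integral_le_mul_sum_of_fibreDom` (generic finite family of non-negative integrable measurable densities `t`, fibre sets `fib`, a bad set `B`, a removal map `rm` (`rm s ∉ B`
not required), real factors `z`; per-history domination on `B` + «`Σ_{s ∈ B : rm s = σ} z s ≤ W` for every `σ`» ⇒ `Σ_{s∈B} ∫ t_s ≤ W·Σ_s ∫ t_s`), `sum_integral_le_mul_sum_image_of_fibreDom` (the
sharper form with the sum over the IMAGE `rm '' B` on the right).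
§3 `sum_le_prod_one_add_sub_one` (a removal fibre injecting into the non-empty sub-families of a finite stock `Old` with `z s ≤ Π_{X ∈ φ s} x X`, `0 ≤ x` ⇒ fibre sum
`≤ Π_{X∈Old}(1 + x X) − 1`), `prod_one_add_sub_one_le_exp_sub_one` (`≤ exp(Σ x) − 1`), `sum_le_exp_sub_one`; ★★ `sum_integral_le_exp_sub_one_mul_sum` (§2 + §3: the bad class weighs at
most `exp(w) − 1` of the total when every removal fibre's stock has `Σ x ≤ w`).
§4 ★★★ `sum_classWeightOfDatum₉_le_mul_sum_of_fibreDom`: at a Stage-9 tuple `ϑ`, datum `D`, `(p, g, k, t)`, for ANY bad set `B` of level-`k` sequences of record, removal map `rm`, fibre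
sets `fib` and factors `z ≥ 0`: the displayed provisos (pieces `χ_k(s)·slot_k(s)` measurable, `≥ 0`, integrable — def-T ∕ K0c shapes) + the per-history letter hDom «`∫⌈_{fib s}(χ_k(s)·slot_k(s))
≤ z s · ∫⌈_{fib s}(χ_k(rm s)·slot_k(rm s))` at every `V`, for `s ∈ B`» + the counting hW ⇒ `Σ_{s∈B} cw_k(s) ≤ W · Σ_s cw_k(s)`; ★★★ `…_of_ratioLetter`: hDom from the sup form on the
ratio + support clause; ★★★ `sum_classWeightOfDatum₉_le_exp_sub_one_mul_sum`: with the multiplicity from compatible families, `≤ (exp w − 1)·Σ_s cw_k(s)`.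

HONEST FRAMING.  [bookkeeping].  hDom ∕ the ratio letter is a HYPOTHESIS — [LF-II] (1.79)∕(1.89)'s KIND read on [IV] (0.3)'s fibre ratio; its identification with print's `𝐓′_k(X)1` is
the cell's open junction NC-NE7b-α; the removal map `rm` on def-T's index is DATA here (def-R `PpSelOfRecord` docstring: no canonical admissibility-preserving deletion — [IV] p. 177 «the
actual procedure is more complicated»); the factors' smallness (κ-budget with the cell's banked renewals, survival rate) is NOT here (`B16Lem384Induction`, `B16Improved189FullBudget`,
`T4PersistentHistoryCount`, `T4WeightBudget` §3).  NO weight is bounded, NO estimate proved; nothing of Bałaban's asserted; NE7 ∕ NE7b ∕ NE7c NOT PRINTED for `d = 4` ∕ NOT proved; no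
`Stage9Params.Provisos` inhabitant claimed (K0⁷ OPEN); K3⁸ untouched; N20 NOT discharged; counts UNMOVED (typed 28∕28 · discharged 8∕27); one finite four-torus programme at fixed `ε` —
NOT ℝ⁴, NOT OS, NOT a mass gap, NOT the Clay problem.  No `def`, no `instance`, no `notation`, no `sorry`; no decl below carries a cite tag.
-/

noncomputable section

open MeasureTheory
open scoped BigOperators ENNReal
open Finset

namespace YMDAG.UVSplit

open Literature.MathematicalPhysics.QuantumFieldTheory.Balaban1983to89
open Literature.MathematicalPhysics.QuantumFieldTheory.Balaban1983to89.T4Continuum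
open Literature.MathematicalPhysics.QuantumFieldTheory.Balaban1983to89.Node00
open Literature.MathematicalPhysics.QuantumFieldTheory.Balaban1983to89.B15.BasicStep
  (fibreIntegral ofReal_comp_measurable lintegral_lmarginal_ofReal_eq)
open Literature.MathematicalPhysics.QuantumFieldTheory.Balaban1983to89.T4ObservableTelescope (integral_fibreIntegral_eq)

/-! ## §1 Fibrewise domination integrates -/

section Fibre

variable {P : Params} {G : Type*} [GaugeGroup G] [MeasurableSpace G] [HaarData G] {j : ℕ}

/-- `∫dV ofReal(∫dV⌈_s f) ≤ ∫dV ofReal(f)` for a measurable density (`ofReal ∘ toReal ≤ id` under the `ℝ≥0∞` tower identity `lintegral_lmarginal_ofReal_eq`; equality when `f` is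
non-negative and integrable).  The bond-decidability instance is implicit (unified from the goal, def-R's convention). [bookkeeping] -/
theorem lintegral_ofReal_fibreIntegral_le {iP : DecidableEq (PBond P j)} (s : Finset (PBond P j)) {f : Density P j G} (hf : Measurable f) :
    ∫⁻ V, ENNReal.ofReal (fibreIntegral s f V) ∂fieldMeasure P j G ≤ ∫⁻ V, ENNReal.ofReal (f V) ∂fieldMeasure P j G := by
  calc ∫⁻ V, ENNReal.ofReal (fibreIntegral s f V) ∂fieldMeasure P j G
      ≤ ∫⁻ V, (∫⋯∫⁻_s, (fun U => ENNReal.ofReal (f U)) ∂(fun _ : PBond P j => (HaarData.haar : Measure G))) V ∂fieldMeasure P j G :=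
        lintegral_mono fun V => ENNReal.ofReal_toReal_le
    _ = ∫⁻ V, ENNReal.ofReal (f V) ∂fieldMeasure P j G := lintegral_lmarginal_ofReal_eq s hf

/-- **An integrable non-negative measurable density has an INTEGRABLE fibre integral** (`∫dV⌈_s f` is measurable — Mathlib `Measurable.lmarginal` —, non-negative, and its `ofReal`-integral is
at most that of `f`). [bookkeeping] -/
theorem integrable_fibreIntegral_of_integrable {iP : DecidableEq (PBond P j)} (s : Finset (PBond P j)) {f : Density P j G} (hf : Measurable f) (h0 : ∀ U, 0 ≤ f U)
    (hfi : Integrable f (fieldMeasure P j G)) : Integrable (fibreIntegral s f) (fieldMeasure P j G) := by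
  have hm : Measurable (fibreIntegral s f) :=
    ((ofReal_comp_measurable hf).lmarginal (fun _ : PBond P j => (HaarData.haar : Measure G))).ennreal_toReal
  have h0F : 0 ≤ᵐ[fieldMeasure P j G] fibreIntegral s f :=
    Filter.Eventually.of_forall fun V => show (0 : ℝ) ≤ fibreIntegral s f V from ENNReal.toReal_nonneg
  refine ⟨hm.aestronglyMeasurable, (hasFiniteIntegral_iff_ofReal h0F).2 ?_⟩
  refine lt_of_le_of_lt (lintegral_ofReal_fibreIntegral_le s hf) ?_
  exact (hasFiniteIntegral_iff_ofReal (Filter.Eventually.of_forall h0)).1 hfi.hasFiniteIntegral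

/-- ★ **FIBREWISE DOMINATION INTEGRATES**: for non-negative integrable measurable densities `f, g` and a real factor `z`, if `∫dV⌈_s f ≤ z·∫dV⌈_s g` at EVERY configuration, then `∫dV f ≤ z·∫dV g`
(`∫dV f = ∫dV ∫dV⌈_s f`, `T4ObservableTelescope.integral_fibreIntegral_eq`, twice; `integral_mono_of_nonneg`). [bookkeeping] -/
theorem integral_le_mul_integral_of_fibreDom {iP : DecidableEq (PBond P j)} (s : Finset (PBond P j)) {f g : Density P j G}
    (hf : Measurable f) (hg : Measurable g) (hf0 : ∀ U, 0 ≤ f U) (hg0 : ∀ U, 0 ≤ g U)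
    (hfi : Integrable f (fieldMeasure P j G)) (hgi : Integrable g (fieldMeasure P j G)) {z : ℝ}
    (hDom : ∀ V, fibreIntegral s f V ≤ z * fibreIntegral s g V) :
    ∫ V, f V ∂fieldMeasure P j G ≤ z * ∫ V, g V ∂fieldMeasure P j G := by
  rw [← integral_fibreIntegral_eq s hf hf0 hfi, ← integral_fibreIntegral_eq s hg hg0 hgi, ← integral_const_mul]
  have h0F : 0 ≤ᵐ[fieldMeasure P j G] fibreIntegral s f :=
    Filter.Eventually.of_forall fun V => show (0 : ℝ) ≤ fibreIntegral s f V from ENNReal.toReal_nonneg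
  exact integral_mono_of_nonneg h0F ((integrable_fibreIntegral_of_integrable s hg hg0 hgi).const_mul z) (Filter.Eventually.of_forall hDom)

/-- **THE DOMINATION FROM A SUP BOUND ON THE RATIO**: if `∫dV⌈_s f ∕ ∫dV⌈_s g ≤ z` at every configuration (real division) and the support clause «`∫dV⌈_s g = 0 ⇒ ∫dV⌈_s f = 0`» holds
(at a vanishing denominator the real ratio is `0` and says nothing), then `∫dV⌈_s f ≤ z·∫dV⌈_s g` everywhere. [bookkeeping] -/
theorem fibreDom_of_ratio_le {iP : DecidableEq (PBond P j)} (s : Finset (PBond P j)) {f g : Density P j G} {z : ℝ}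
    (hratio : ∀ V, fibreIntegral s f V / fibreIntegral s g V ≤ z) (hsupp : ∀ V, fibreIntegral s g V = 0 → fibreIntegral s f V = 0)
    (V : GaugeField P j G) : fibreIntegral s f V ≤ z * fibreIntegral s g V := by
  have hg0 : (0 : ℝ) ≤ fibreIntegral s g V := ENNReal.toReal_nonneg
  rcases eq_or_lt_of_le hg0 with h | h
  · have hg : fibreIntegral s g V = 0 := h.symm
    rw [hg, hsupp V hg, mul_zero]
  · exact (div_le_iff₀ h).1 (hratio V)

/-- **… ON def-R's (0.3) RATIO**: for a (2.18) representation `r` with fibre sets `fib`, a sup bound `rratio r fib a a′ ≤ z` on the ratio `∫⌈_{fib a} t_a ∕ ∫⌈_{fib a} t_{a′}` of the TERMS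
`t = rterm r` together with the support clause gives the fibrewise domination of `t_a` by `t_{a′}` on `fib a`. [bookkeeping] -/
theorem fibreDom_of_rratio_le {iP : DecidableEq (PBond P j)} (r : Step.Repr218 P G j) (fib : r.Adm → Finset (PBond P j)) (a a' : r.Adm) {z : ℝ}
    (hratio : ∀ V, rratio r fib a a' V ≤ z)
    (hsupp : ∀ V, fibreIntegral (fib a) (rterm r a') V = 0 → fibreIntegral (fib a) (rterm r a) V = 0) (V : GaugeField P j G) :
    fibreIntegral (fib a) (rterm r a) V ≤ z * fibreIntegral (fib a) (rterm r a') V :=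
  fibreDom_of_ratio_le (fib a) hratio hsupp V

end Fibre

/-! ## §2 The bad class is dominated by the image classes, with the fibre multiplicity -/

section Class

variable {P : Params} {G : Type*} [GaugeGroup G] [MeasurableSpace G] [HaarData G] {j : ℕ}
variable {ι : Type*} [DecidableEq ι]

/-- ★★ **A BAD CLASS WEIGHS AT MOST ITS FIBRE MULTIPLICITY TIMES THE IMAGE CLASSES.**  Finite family of non-negative integrable measurable densities `t`, fibre sets `fib`, a bad set `B`, a
removal map `rm`, factors `z`: if every `s ∈ B` is fibrewise dominated — `∫⌈_{fib s} t_s ≤ z s·∫⌈_{fib s} t_{rm s}` everywhere — and the factors re-inserted over each removal fibre sum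
to at most `W` — `Σ_{s ∈ B : rm s = σ} z s ≤ W` for every `σ` in the image — then `Σ_{s∈B} ∫ t_s ≤ W · Σ_{σ ∈ rm(B)} ∫ t_σ` (§1 per history; `Finset.sum_fiberwise_le_sum_of_…`-type regrouping
by the value of `rm`). [bookkeeping] -/
theorem sum_integral_le_mul_sum_image_of_fibreDom {iP : DecidableEq (PBond P j)} (t : ι → Density P j G) (fib : ι → Finset (PBond P j))
    (B : Finset ι) (rm : ι → ι) (z : ι → ℝ) {W : ℝ}
    (hm : ∀ s, Measurable (t s)) (h0 : ∀ s V, 0 ≤ t s V) (hint : ∀ s, Integrable (t s) (fieldMeasure P j G))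
    (hDom : ∀ s ∈ B, ∀ V, fibreIntegral (fib s) (t s) V ≤ z s * fibreIntegral (fib s) (t (rm s)) V)
    (hW : ∀ σ ∈ B.image rm, ∑ s ∈ B.filter (fun s => rm s = σ), z s ≤ W) :
    ∑ s ∈ B, ∫ V, t s V ∂fieldMeasure P j G ≤ W * ∑ σ ∈ B.image rm, ∫ V, t σ V ∂fieldMeasure P j G := by
  have hI0 : ∀ s, 0 ≤ ∫ V, t s V ∂fieldMeasure P j G := fun s => integral_nonneg (h0 s)
  calc ∑ s ∈ B, ∫ V, t s V ∂fieldMeasure P j G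
      ≤ ∑ s ∈ B, z s * ∫ V, t (rm s) V ∂fieldMeasure P j G :=
        Finset.sum_le_sum fun s hs =>
          integral_le_mul_integral_of_fibreDom (fib s) (hm s) (hm (rm s)) (h0 s) (h0 (rm s)) (hint s) (hint (rm s)) (hDom s hs)
    _ = ∑ σ ∈ B.image rm, ∑ s ∈ B.filter (fun s => rm s = σ), z s * ∫ V, t (rm s) V ∂fieldMeasure P j G :=
        (Finset.sum_fiberwise_of_maps_to (fun s hs => Finset.mem_image_of_mem rm hs) _).symm
    _ = ∑ σ ∈ B.image rm, (∑ s ∈ B.filter (fun s => rm s = σ), z s) * ∫ V, t σ V ∂fieldMeasure P j G := by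
        refine Finset.sum_congr rfl fun σ _ => ?_
        rw [Finset.sum_mul]
        refine Finset.sum_congr rfl fun s hs => ?_
        rw [(Finset.mem_filter.1 hs).2]
    _ ≤ ∑ σ ∈ B.image rm, W * ∫ V, t σ V ∂fieldMeasure P j G :=
        Finset.sum_le_sum fun σ hσ => mul_le_mul_of_nonneg_right (hW σ hσ) (hI0 σ)
    _ = W * ∑ σ ∈ B.image rm, ∫ V, t σ V ∂fieldMeasure P j G := by rw [Finset.mul_sum]

/-- ★★ **… HENCE AT MOST `W` OF THE TOTAL** (`0 ≤ W`; the image classes are among all classes and every class weight is `≥ 0`): `Σ_{s∈B} ∫ t_s ≤ W · Σ_s ∫ t_s` — the shape of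
`T4WeightBudget.RelWeightBound.bad_left ∕ bad_right` at one `(K, t)`, and of the level letters of `…CoPHKComponentSizeBlocks`. [bookkeeping] -/
theorem sum_integral_le_mul_sum_of_fibreDom [Fintype ι] {iP : DecidableEq (PBond P j)} (t : ι → Density P j G) (fib : ι → Finset (PBond P j))
    (B : Finset ι) (rm : ι → ι) (z : ι → ℝ) {W : ℝ} (hW0 : 0 ≤ W)
    (hm : ∀ s, Measurable (t s)) (h0 : ∀ s V, 0 ≤ t s V) (hint : ∀ s, Integrable (t s) (fieldMeasure P j G))
    (hDom : ∀ s ∈ B, ∀ V, fibreIntegral (fib s) (t s) V ≤ z s * fibreIntegral (fib s) (t (rm s)) V)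
    (hW : ∀ σ ∈ B.image rm, ∑ s ∈ B.filter (fun s => rm s = σ), z s ≤ W) :
    ∑ s ∈ B, ∫ V, t s V ∂fieldMeasure P j G ≤ W * ∑ s, ∫ V, t s V ∂fieldMeasure P j G :=
  (sum_integral_le_mul_sum_image_of_fibreDom t fib B rm z hm h0 hint hDom hW).trans
    (mul_le_mul_of_nonneg_left (Finset.sum_le_sum_of_subset_of_nonneg (Finset.subset_univ _) fun s _ _ => integral_nonneg (h0 s)) hW0)

end Class

/-! ## §3 The fibre multiplicity of multiplicative factors over compatible families of old components -/

section Counting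

variable {ι : Type*} {X : Type*} [DecidableEq X]

/-- **A REMOVAL FIBRE OF MULTIPLICATIVE FACTORS SUMS TO AT MOST `Π(1 + x) − 1`.**  If the fibre `S` (the bad histories collapsing to one image) injects (`φ`) into the NON-EMPTY
sub-families of a finite stock `Old` of candidate components, with `z s ≤ Π_{X ∈ φ s} x X` and `0 ≤ x`, then `Σ_{s∈S} z s ≤ Π_{X ∈ Old}(1 + x X) − 1` (`Finset.prod_one_add`: the product
expands over ALL sub-families; the empty one contributes the `1`). [bookkeeping] -/
theorem sum_le_prod_one_add_sub_one (S : Finset ι) (Old : Finset X) (φ : ι → Finset X) (z : ι → ℝ) (x : X → ℝ) (hx : ∀ X ∈ Old, 0 ≤ x X)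
    (hφ : ∀ s ∈ S, φ s ⊆ Old ∧ (φ s).Nonempty) (hinj : Set.InjOn φ S) (hz : ∀ s ∈ S, z s ≤ ∏ X ∈ φ s, x X) :
    ∑ s ∈ S, z s ≤ (∏ X ∈ Old, (1 + x X)) - 1 := by
  have hsub : S.image φ ⊆ Old.powerset.erase ∅ := by
    intro C hC
    obtain ⟨s, hs, rfl⟩ := Finset.mem_image.1 hC
    exact Finset.mem_erase.2 ⟨(hφ s hs).2.ne_empty, Finset.mem_powerset.2 (hφ s hs).1⟩
  have hnn : ∀ C ∈ Old.powerset.erase ∅, 0 ≤ ∏ X ∈ C, x X := fun C hC =>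
    Finset.prod_nonneg fun X hX => hx X (Finset.mem_powerset.1 (Finset.mem_erase.1 hC).2 hX)
  calc ∑ s ∈ S, z s ≤ ∑ s ∈ S, ∏ X ∈ φ s, x X := Finset.sum_le_sum hz
    _ = ∑ C ∈ S.image φ, ∏ X ∈ C, x X := by rw [Finset.sum_image hinj]
    _ ≤ ∑ C ∈ Old.powerset.erase ∅, ∏ X ∈ C, x X := Finset.sum_le_sum_of_subset_of_nonneg hsub fun C hC _ => hnn C hC
    _ = (∑ C ∈ Old.powerset, ∏ X ∈ C, x X) - ∏ X ∈ (∅ : Finset X), x X := by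
        rw [Finset.sum_erase_eq_sub (Finset.empty_mem_powerset Old)]
    _ = (∏ X ∈ Old, (1 + x X)) - 1 := by rw [Finset.prod_empty, Finset.prod_one_add]

omit [DecidableEq X] in
/-- `Π_{X∈Old}(1 + x X) − 1 ≤ exp(Σ_{X∈Old} x X) − 1` for `0 ≤ x` (`1 + u ≤ e^u`). [bookkeeping] -/
theorem prod_one_add_sub_one_le_exp_sub_one (Old : Finset X) (x : X → ℝ) (hx : ∀ X ∈ Old, 0 ≤ x X) :
    (∏ X ∈ Old, (1 + x X)) - 1 ≤ Real.exp (∑ X ∈ Old, x X) - 1 := by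
  refine sub_le_sub_right ?_ 1
  rw [Real.exp_sum]
  exact Finset.prod_le_prod (fun X hX => by linarith [hx X hX]) fun X _ => by linarith [Real.add_one_le_exp (x X)]

/-- **THE FIBRE MULTIPLICITY BOUND, assembled**: under the hypotheses of `sum_le_prod_one_add_sub_one`, `Σ_{s∈S} z s ≤ exp(Σ_{X∈Old} x X) − 1`. [bookkeeping] -/
theorem sum_le_exp_sub_one (S : Finset ι) (Old : Finset X) (φ : ι → Finset X) (z : ι → ℝ) (x : X → ℝ) (hx : ∀ X ∈ Old, 0 ≤ x X)
    (hφ : ∀ s ∈ S, φ s ⊆ Old ∧ (φ s).Nonempty) (hinj : Set.InjOn φ S) (hz : ∀ s ∈ S, z s ≤ ∏ X ∈ φ s, x X) :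
    ∑ s ∈ S, z s ≤ Real.exp (∑ X ∈ Old, x X) - 1 :=
  (sum_le_prod_one_add_sub_one S Old φ z x hx hφ hinj hz).trans (prod_one_add_sub_one_le_exp_sub_one Old x hx)

/-- ★★ **§2 + §3 ASSEMBLED (generic)**: per-history fibrewise domination on the bad set, every removal fibre injecting into the non-empty compatible sub-families of a stock `Old σ`
of candidate components with multiplicative majorants `z s ≤ Π_{X∈φ σ s} x X` (`0 ≤ x`), and a UNIFORM bound `Σ_{X ∈ Old σ} x X ≤ w` ⇒ the bad class weighs at most `exp(w) − 1` of
the total. [bookkeeping] -/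
theorem sum_integral_le_exp_sub_one_mul_sum {P : Params} {G : Type*} [GaugeGroup G] [MeasurableSpace G] [HaarData G] {j : ℕ} [Fintype ι] [DecidableEq ι]
    {iP : DecidableEq (PBond P j)} (t : ι → Density P j G) (fib : ι → Finset (PBond P j)) (B : Finset ι) (rm : ι → ι) (z : ι → ℝ)
    (hm : ∀ s, Measurable (t s)) (h0 : ∀ s V, 0 ≤ t s V) (hint : ∀ s, Integrable (t s) (fieldMeasure P j G))
    (hDom : ∀ s ∈ B, ∀ V, fibreIntegral (fib s) (t s) V ≤ z s * fibreIntegral (fib s) (t (rm s)) V)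
    (Old : ι → Finset X) (φ : ι → ι → Finset X) (x : X → ℝ) {w : ℝ} (hx : ∀ σ, ∀ X ∈ Old σ, 0 ≤ x X)
    (hφ : ∀ σ, ∀ s ∈ B.filter (fun s => rm s = σ), φ σ s ⊆ Old σ ∧ (φ σ s).Nonempty) (hinj : ∀ σ, Set.InjOn (φ σ) (B.filter (fun s => rm s = σ)))
    (hz : ∀ σ, ∀ s ∈ B.filter (fun s => rm s = σ), z s ≤ ∏ X ∈ φ σ s, x X) (hw : ∀ σ, ∑ X ∈ Old σ, x X ≤ w) :
    ∑ s ∈ B, ∫ V, t s V ∂fieldMeasure P j G ≤ (Real.exp w - 1) * ∑ s, ∫ V, t s V ∂fieldMeasure P j G := by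
  rcases isEmpty_or_nonempty ι with hι | hι
  · simp [Finset.eq_empty_of_isEmpty B, Finset.univ_eq_empty]
  · obtain ⟨i⟩ := hι
    have hw0 : 0 ≤ w := le_trans (Finset.sum_nonneg fun X hX => hx (rm i) X hX) (hw (rm i))
    exact sum_integral_le_mul_sum_of_fibreDom t fib B rm z (sub_nonneg.2 (Real.one_le_exp hw0)) hm h0 hint hDom
      fun σ _ => (sum_le_exp_sub_one _ (Old σ) (φ σ) z x (hx σ) (hφ σ) (hinj σ) (hz σ)).trans
        (sub_le_sub_right (Real.exp_le_exp.2 (hw σ)) 1)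

end Counting

/-! ## §4 Of record: the dressed class weights of a Stage-9 tuple at one `(p, g, k, t)` -/

section Record

variable {F : T4Family} {N : ℕ} [NeZero N]
variable (ϑ : Stage9Params F N) (D : FiniteEpsData F (SU N)) (g₀ : ℕ → ℝ) (os : List (ULoop F)) (p : B12.RunParams) (g : ℕ → ℝ) (k : ℕ) (t : ℝ)

open scoped Classical in
/-- ★★★ **N20's BAD-CLASS INEQUALITY AT ONE `(p, g, k, t)` FROM ONE PER-HISTORY FIBREWISE LETTER.**  For ANY bad set `B` of level-`k` sequences of record, removal map `rm`, fibre
sets `fib` and real factors `z`: under the displayed provisos on the pieces `χ_k(s)·slot_k(s)` of the dressed family (measurable, `≥ 0`, integrable — def-T ∕ K0c shapes), the letter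
hDom «`∫⌈_{fib s}(χ_k(s)·slot_k(s)) ≤ z s · ∫⌈_{fib s}(χ_k(rm s)·slot_k(rm s))` at every `V`, for `s ∈ B`» ([LF-II] (1.79) ∕ improved (1.89) read on [IV] (0.3)'s fibre ratio — a
HYPOTHESIS) and the counting hW «`Σ_{s ∈ B : rm s = σ} z s ≤ W`» give `Σ_{s∈B} cw_k(s) ≤ W · Σ_s cw_k(s)` for the class weights `cw = classWeightOfDatum₉`. [bookkeeping] -/
theorem sum_classWeightOfDatum₉_le_mul_sum_of_fibreDom (B : Finset (SeqOfRecord F ϑ.ν ϑ.τ9.M g p.K k))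
    (rm : SeqOfRecord F ϑ.ν ϑ.τ9.M g p.K k → SeqOfRecord F ϑ.ν ϑ.τ9.M g p.K k)
    (fib : SeqOfRecord F ϑ.ν ϑ.τ9.M g p.K k → Finset (PBond (F.P p.K) k)) (z : SeqOfRecord F ϑ.ν ϑ.τ9.M g p.K k → ℝ) {W : ℝ} (hW0 : 0 ≤ W)
    (hm : ∀ s, Measurable fun V => chiSeqOfRecord F N ϑ.ν ϑ.τ9.M g p.K k s V * dressedSlotsOfDatum₉ F N ϑ D g₀ os t p g k s V)
    (h0 : ∀ s V, 0 ≤ chiSeqOfRecord F N ϑ.ν ϑ.τ9.M g p.K k s V * dressedSlotsOfDatum₉ F N ϑ D g₀ os t p g k s V)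
    (hint : ∀ s, Integrable (fun V => chiSeqOfRecord F N ϑ.ν ϑ.τ9.M g p.K k s V * dressedSlotsOfDatum₉ F N ϑ D g₀ os t p g k s V)
      (fieldMeasure (F.P p.K) k (SU N)))
    (hDom : ∀ s ∈ B, ∀ V,
      fibreIntegral (fib s) (fun V => chiSeqOfRecord F N ϑ.ν ϑ.τ9.M g p.K k s V * dressedSlotsOfDatum₉ F N ϑ D g₀ os t p g k s V) V ≤
        z s * fibreIntegral (fib s) (fun V => chiSeqOfRecord F N ϑ.ν ϑ.τ9.M g p.K k (rm s) V * dressedSlotsOfDatum₉ F N ϑ D g₀ os t p g k (rm s) V) V)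
    (hW : ∀ σ ∈ B.image rm, ∑ s ∈ B.filter (fun s => rm s = σ), z s ≤ W) :
    ∑ s ∈ B, classWeightOfDatum₉ F N ϑ D g₀ os p g k t s ≤ W * ∑ s, classWeightOfDatum₉ F N ϑ D g₀ os p g k t s := by
  classical
  unfold classWeightOfDatum₉
  exact sum_integral_le_mul_sum_of_fibreDom
    (fun s V => chiSeqOfRecord F N ϑ.ν ϑ.τ9.M g p.K k s V * dressedSlotsOfDatum₉ F N ϑ D g₀ os t p g k s V) fib B rm z hW0 hm h0 hint hDom hW

open scoped Classical in
/-- ★★★ **… FROM THE SUP FORM OF THE LETTER**: the same with hDom replaced by a sup bound on the (0.3) RATIO of the two pieces' fibre integrals, `∫⌈ t_s ∕ ∫⌈ t_{rm s} ≤ z s` at every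
`V`, plus the support clause «`∫⌈ t_{rm s} = 0 ⇒ ∫⌈ t_s = 0`» (print: [IV] (0.3) «the denominators are positive»). [bookkeeping] -/
theorem sum_classWeightOfDatum₉_le_mul_sum_of_ratioLetter (B : Finset (SeqOfRecord F ϑ.ν ϑ.τ9.M g p.K k))
    (rm : SeqOfRecord F ϑ.ν ϑ.τ9.M g p.K k → SeqOfRecord F ϑ.ν ϑ.τ9.M g p.K k)
    (fib : SeqOfRecord F ϑ.ν ϑ.τ9.M g p.K k → Finset (PBond (F.P p.K) k)) (z : SeqOfRecord F ϑ.ν ϑ.τ9.M g p.K k → ℝ) {W : ℝ} (hW0 : 0 ≤ W)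
    (hm : ∀ s, Measurable fun V => chiSeqOfRecord F N ϑ.ν ϑ.τ9.M g p.K k s V * dressedSlotsOfDatum₉ F N ϑ D g₀ os t p g k s V)
    (h0 : ∀ s V, 0 ≤ chiSeqOfRecord F N ϑ.ν ϑ.τ9.M g p.K k s V * dressedSlotsOfDatum₉ F N ϑ D g₀ os t p g k s V)
    (hint : ∀ s, Integrable (fun V => chiSeqOfRecord F N ϑ.ν ϑ.τ9.M g p.K k s V * dressedSlotsOfDatum₉ F N ϑ D g₀ os t p g k s V)
      (fieldMeasure (F.P p.K) k (SU N)))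
    (hratio : ∀ s ∈ B, ∀ V,
      fibreIntegral (fib s) (fun V => chiSeqOfRecord F N ϑ.ν ϑ.τ9.M g p.K k s V * dressedSlotsOfDatum₉ F N ϑ D g₀ os t p g k s V) V /
        fibreIntegral (fib s) (fun V => chiSeqOfRecord F N ϑ.ν ϑ.τ9.M g p.K k (rm s) V * dressedSlotsOfDatum₉ F N ϑ D g₀ os t p g k (rm s) V) V ≤ z s)
    (hsupp : ∀ s ∈ B, ∀ V,
      fibreIntegral (fib s) (fun V => chiSeqOfRecord F N ϑ.ν ϑ.τ9.M g p.K k (rm s) V * dressedSlotsOfDatum₉ F N ϑ D g₀ os t p g k (rm s) V) V = 0 →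
        fibreIntegral (fib s) (fun V => chiSeqOfRecord F N ϑ.ν ϑ.τ9.M g p.K k s V * dressedSlotsOfDatum₉ F N ϑ D g₀ os t p g k s V) V = 0)
    (hW : ∀ σ ∈ B.image rm, ∑ s ∈ B.filter (fun s => rm s = σ), z s ≤ W) :
    ∑ s ∈ B, classWeightOfDatum₉ F N ϑ D g₀ os p g k t s ≤ W * ∑ s, classWeightOfDatum₉ F N ϑ D g₀ os p g k t s := by
  classical
  exact sum_classWeightOfDatum₉_le_mul_sum_of_fibreDom ϑ D g₀ os p g k t B rm fib z hW0 hm h0 hint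
    (fun s hs V => fibreDom_of_ratio_le (fib s) (hratio s hs) (hsupp s hs) V) hW

open scoped Classical in
/-- ★★★ **… WITH THE FIBRE MULTIPLICITY FROM COMPATIBLE FAMILIES OF OLD COMPONENTS**: the same letter hDom, every removal fibre injecting into the non-empty sub-families of a stock
`Old σ` of candidate components with multiplicative majorants `z s ≤ Π_{X ∈ φ σ s} x X` (`0 ≤ x`) and the uniform smallness `Σ_{X∈Old σ} x X ≤ w` ⇒ the bad class weighs at most
`exp(w) − 1` of the total — the activities' smallness `w` is where the κ-budget and the survival rate enter (NOT here). [bookkeeping] -/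
theorem sum_classWeightOfDatum₉_le_exp_sub_one_mul_sum {X : Type*} (B : Finset (SeqOfRecord F ϑ.ν ϑ.τ9.M g p.K k))
    (rm : SeqOfRecord F ϑ.ν ϑ.τ9.M g p.K k → SeqOfRecord F ϑ.ν ϑ.τ9.M g p.K k)
    (fib : SeqOfRecord F ϑ.ν ϑ.τ9.M g p.K k → Finset (PBond (F.P p.K) k)) (z : SeqOfRecord F ϑ.ν ϑ.τ9.M g p.K k → ℝ)
    (hm : ∀ s, Measurable fun V => chiSeqOfRecord F N ϑ.ν ϑ.τ9.M g p.K k s V * dressedSlotsOfDatum₉ F N ϑ D g₀ os t p g k s V)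
    (h0 : ∀ s V, 0 ≤ chiSeqOfRecord F N ϑ.ν ϑ.τ9.M g p.K k s V * dressedSlotsOfDatum₉ F N ϑ D g₀ os t p g k s V)
    (hint : ∀ s, Integrable (fun V => chiSeqOfRecord F N ϑ.ν ϑ.τ9.M g p.K k s V * dressedSlotsOfDatum₉ F N ϑ D g₀ os t p g k s V)
      (fieldMeasure (F.P p.K) k (SU N)))
    (hDom : ∀ s ∈ B, ∀ V,
      fibreIntegral (fib s) (fun V => chiSeqOfRecord F N ϑ.ν ϑ.τ9.M g p.K k s V * dressedSlotsOfDatum₉ F N ϑ D g₀ os t p g k s V) V ≤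
        z s * fibreIntegral (fib s) (fun V => chiSeqOfRecord F N ϑ.ν ϑ.τ9.M g p.K k (rm s) V * dressedSlotsOfDatum₉ F N ϑ D g₀ os t p g k (rm s) V) V)
    (Old : SeqOfRecord F ϑ.ν ϑ.τ9.M g p.K k → Finset X) (φ : SeqOfRecord F ϑ.ν ϑ.τ9.M g p.K k → SeqOfRecord F ϑ.ν ϑ.τ9.M g p.K k → Finset X)
    (x : X → ℝ) {w : ℝ} (hx : ∀ σ, ∀ X ∈ Old σ, 0 ≤ x X)
    (hφ : ∀ σ, ∀ s ∈ B.filter (fun s => rm s = σ), φ σ s ⊆ Old σ ∧ (φ σ s).Nonempty) (hinj : ∀ σ, Set.InjOn (φ σ) (B.filter (fun s => rm s = σ)))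
    (hz : ∀ σ, ∀ s ∈ B.filter (fun s => rm s = σ), z s ≤ ∏ X ∈ φ σ s, x X) (hw : ∀ σ, ∑ X ∈ Old σ, x X ≤ w) :
    ∑ s ∈ B, classWeightOfDatum₉ F N ϑ D g₀ os p g k t s ≤ (Real.exp w - 1) * ∑ s, classWeightOfDatum₉ F N ϑ D g₀ os p g k t s := by
  classical
  unfold classWeightOfDatum₉
  exact sum_integral_le_exp_sub_one_mul_sum
    (fun s V => chiSeqOfRecord F N ϑ.ν ϑ.τ9.M g p.K k s V * dressedSlotsOfDatum₉ F N ϑ D g₀ os t p g k s V) fib B rm z hm h0 hint hDom Old φ x hx hφ hinj hz hw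

end Record

end YMDAG.UVSplit
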